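import Literature.Analysis.Calculus.UltrametricNewtonChart                 -- ★ D1 (F0P2-p01): `exists_depth_linearNewton_of_hasStrictFDerivAt`
import Literature.Analysis.Matrix.UltrametricElementwiseNormCalculus       -- ★ (U) (F0P3a-p05): `hasStrictFDerivAt_cayleyConj_add_elementwise`
import Literature.LinearAlgebra.Matrix.MinimalNilpotentSliceFinThree       -- ★ (D) (F0P3-p02): the Slodowy data at `N = c·E₀₂`, §2 ∕ §4 ∕ §6
import Mathlib.Analysis.Normed.Module.FiniteDimension
import Mathlib.Topology.Algebra.Module.FiniteDimension
import HarnessLib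

/-!
# F0 · P3c · line LH6 «StCharTS» — ROAD «HC-D», brick D5(iii), sub-brick (iii-K) «SLODOWY SLICE MAP, `K`-LEVEL»: the linear part
# `e_K (Y, Z) = 2(NY − YN) + Z : range (ad N⁻) × ker (ad N⁻) ≃L[K] M₃(K)` at the minimal nilpotent `N = c·E₀₂` (`N⁻ = E₂₀`), the strict derivative of the
# slice map `Ψ(Y, Z) = c(Y)(N + Z)c(Y)⁻¹` at `0`, and its NEWTON DATA

Cell `pub/hodgecm-mathlib`, crux H413 = `stmt-HodgeConjecture-24833` (lane `--supports … --as helper`), route HCCMUnconditional; seat LH10-p01 (g7), co-hand sub-brick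
(iii-K) of D5(iii) (holder A-p12 (g29), offer 2026-09-02T16:49:52Z) on F0P2-p01 (g23)'s road «HC-D».  THEOREMS ONLY (no definition ∕ instance ∕ notation ∕ named fact ∕
`sorry`); imports ★ D1 + ★ (U) + ★ (D) + Mathlib.  The ★ C₁ `F0P3cStCharTSHCDescentSemisimpleSliceK` §1 ANALOGUE FOR THE NILPOTENT PAIR: there the slice through a
semisimple `S₀` is modelled on `range (ad S₀) × ker (ad S₀)`; here, at the minimal nilpotent `N = c·E₀₂`, the transversal complement of `𝔷(N⁻)` is the `θ`-stable
`range (ad N⁻)` (★ (D) §6: `M₃ = [N, range (ad N⁻)] ⊕ 𝔷(N⁻)`, the `𝔰𝔩₂`-splitting `ker (ad e) ⊕ range (ad f)`).  Consumer: A-p12's C₂-analogue (descent to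
`↥Q × ↥C ≃ₜ+ ↥𝔲₀`, exact box images, DOWN∕UP slice identities) and the D5(iii) assembly.
HONEST LABEL: HC_CM is proved only modulo the 7 printed citations (2 remaining: hLiu418 = `stmt-HodgeConjecture-24832`, h413 = `stmt-HodgeConjecture-24833`) until rung 0
closes; count-neutral analysis for the named input (HC-D) «`|D_G|^{−1∕2} ∈ L¹_loc(G)`» [HarishChandra1970, Part VII §1 Thm. 15]; closes no organ.

THE MATHEMATICS ([HarishChandra1970, Part V §4 Lemma 22]; [Humphreys1972, §7.2]; [Schikhof1984, §27]).  `K` complete ultrametric nontrivially normed, `2 ≠ 0`, `c ≠ 0`;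
`M₃(K)` with the ELEMENTWISE sup norm (`open scoped Matrix.Norms.Elementwise`, R1); `ad X = L_X − R_X`; `N⁻ = E₂₀ = single 2 0 1`, `Q_K = range (ad N⁻)`, `C_K = ker (ad N⁻)`,
`N = single 0 2 c`.
* §0 `mem_range_ad_single_two_zero_iff` ∕ `mem_ker_ad_single_two_zero_iff` — the carriers ENTRYWISE (★ (D) §2, §6): `Q_K = {Y ∣ Y₀₁ = Y₀₂ = Y₁₁ = Y₁₂ = 0, Y₀₀ + Y₂₂ = 0}`,
  `C_K = {W ∣ W E₂₀ = E₂₀ W}`.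
* §1 (K1) `exists_slodowyLinearEquivK` — **`e_K : Q_K × C_K ≃L[K] M₃(K)`, `e_K (Y, Z) = 2(NY − YN) + Z`** (onto: ★ (D) `exists_mem_range_bracket_add_centralizer`; one-to-one:
  ★ (D) `bracket_eq_zero_of_commute_single_two_zero` + `eq_zero_of_mem_range_of_bracket_eq_zero`; bi-continuity automatic in finite dimension);
  (K2) `hasStrictFDerivAt_slodowySlice` — **`HasStrictFDerivAt Ψ e_K 0`** (★ (U) composed with the subspace inclusions);
  (K3) `exists_newtonData_slodowyK` — the Newton data of ★ D1; both as instances of the SUBSPACE-GENERIC heads `hasStrictFDerivAt_conjSlice` ∕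
  `exists_newtonData_conjSlice` (any `A`, any pair of subspaces `Q`, `C` with `e (Y,Z) = 2(AY − YA) + Z` an iso), usable by every further slice of the road.

## References
* [HarishChandra1970] Harish-Chandra (notes by G. van Dijk), *Harmonic Analysis on Reductive p-adic Groups*, LNM 162 (1970), Part V §4 Lemma 22; Part VII §1 Thm. 15.
* [Humphreys1972] J. E. Humphreys, *Introduction to Lie Algebras and Representation Theory* (1972), §7.2 (`𝔰𝔩₂`-modules: `V = ker e ⊕ im f`).
* [Schikhof1984] W. H. Schikhof, *Ultrametric Calculus*, Cambridge (1984), §27.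
* [Slodowy1980] P. Slodowy, *Simple Singularities and Simple Algebraic Groups*, LNM 815 (1980), §7.4 (the transversal slice `e + 𝔷(f)`) — context only.
-/

set_option autoImplicit false
-- the mandated namespace has the single-problem summit's repeated segment (`HodgeConjecture.HodgeConjecture`)
set_option linter.dupNamespace false

noncomputable section

open Filter Metric Set Matrix
open scoped Matrix Matrix.Norms.Elementwise Topology
open Literature.Analysis.Calculus Literature.Analysis.Matrix Literature.LinearAlgebra.Matrix

namespace Summit.HodgeConjecture.HodgeConjecture.Cruxes.H413.F0P3cStCharTSHCDSlodowySliceK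

/-! ## §0 The carriers `Q_K = range (ad E₂₀)` and `C_K = ker (ad E₂₀)`, entrywise -/

section Carriers

variable {K : Type*} [Field K]

/-- `ad X = L_X − R_X` applied: `(ad X) A = XA − AX`. [folklore] -/
private theorem ad_apply (X A : Matrix (Fin 3) (Fin 3) K) :
    (LinearMap.mulLeft K X - LinearMap.mulRight K X : Module.End K (Matrix (Fin 3) (Fin 3) K)) A = X * A - A * X := rfl

/-- **`Q_K = range (ad E₂₀)` ENTRYWISE**: `Y ∈ range (ad E₂₀) ↔ Y₀₁ = Y₀₂ = Y₁₁ = Y₁₂ = 0 ∧ Y₀₀ + Y₂₂ = 0` (→ ★ (D) `bracket_single_two_zero_mem_range`; ← the explicit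
preimage `A = (Y₂₀, Y₂₁, Y₂₂ ; 0, 0, −Y₁₀ ; 0, 0, 0)`). [cite: Humphreys1972, §7.2] -/
theorem mem_range_ad_single_two_zero_iff (Y : Matrix (Fin 3) (Fin 3) K) :
    Y ∈ LinearMap.range (LinearMap.mulLeft K (single (2 : Fin 3) (0 : Fin 3) (1 : K)) - LinearMap.mulRight K (single (2 : Fin 3) (0 : Fin 3) (1 : K)) :
        Module.End K (Matrix (Fin 3) (Fin 3) K)) ↔
      Y 0 1 = 0 ∧ Y 0 2 = 0 ∧ Y 1 1 = 0 ∧ Y 1 2 = 0 ∧ Y 0 0 + Y 2 2 = 0 := by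
  constructor
  · rintro ⟨A, rfl⟩
    rw [ad_apply]
    exact bracket_single_two_zero_mem_range (1 : K) A
  · rintro ⟨h01, h02, h11, h12, htr⟩
    refine ⟨!![Y 2 0, Y 2 1, Y 2 2; 0, 0, -(Y 1 0); 0, 0, 0], ?_⟩
    rw [ad_apply, single_two_zero_bracket_eq]
    have h00 : Y 0 0 = -(Y 2 2) := by linear_combination htr
    ext i j
    fin_cases i <;> fin_cases j <;> simp [h01, h02, h11, h12, h00]

/-- **`C_K = ker (ad E₂₀)` = the centraliser `𝔷(E₂₀)`**: `W ∈ ker (ad E₂₀) ↔ W E₂₀ = E₂₀ W` (★ (D) `commute_single_two_zero_iff` makes it entrywise).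
[cite: Humphreys1972, §7.2] -/
theorem mem_ker_ad_single_two_zero_iff (W : Matrix (Fin 3) (Fin 3) K) :
    W ∈ LinearMap.ker (LinearMap.mulLeft K (single (2 : Fin 3) (0 : Fin 3) (1 : K)) - LinearMap.mulRight K (single (2 : Fin 3) (0 : Fin 3) (1 : K)) :
        Module.End K (Matrix (Fin 3) (Fin 3) K)) ↔
      W * single (2 : Fin 3) (0 : Fin 3) (1 : K) = single (2 : Fin 3) (0 : Fin 3) 1 * W := by
  rw [LinearMap.mem_ker, ad_apply, sub_eq_zero, eq_comm]

end Carriers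

/-! ## §1 The `K`-level: linear part `e_K`, strict derivative of the slice map, Newton data -/

section KLevel

variable {K : Type*} [NontriviallyNormedField K] [IsUltrametricDist K] [CompleteSpace K]

/-- **(K1) The `K`-linear part `e_K : Q_K × C_K ≃L[K] M₃(K)`, `e_K (Y, Z) = 2(NY − YN) + Z`** for `N = c·E₀₂` (`c ≠ 0`, `2 ≠ 0`), `Q_K = range (ad E₂₀)`,
`C_K = ker (ad E₂₀)`: onto by ★ (D) `exists_mem_range_bracket_add_centralizer`, one-to-one by ★ (D) `bracket_eq_zero_of_commute_single_two_zero` +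
`eq_zero_of_mem_range_of_bracket_eq_zero`; continuity is automatic (finite dimension).  The sign is ★ (U)'s (`2 • (N * Y − Y * N) + Z`).
[cite: Humphreys1972, §7.2] [cite: HarishChandra1970, Part V §4 Lemma 22] -/
theorem exists_slodowyLinearEquivK {c : K} (hc : c ≠ 0) (h2 : (2 : K) ≠ 0) :
    ∃ eK : (↥(LinearMap.range (LinearMap.mulLeft K (single (2 : Fin 3) (0 : Fin 3) (1 : K)) - LinearMap.mulRight K (single (2 : Fin 3) (0 : Fin 3) (1 : K)) :
                Module.End K (Matrix (Fin 3) (Fin 3) K))) ×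
            ↥(LinearMap.ker (LinearMap.mulLeft K (single (2 : Fin 3) (0 : Fin 3) (1 : K)) - LinearMap.mulRight K (single (2 : Fin 3) (0 : Fin 3) (1 : K)) :
                Module.End K (Matrix (Fin 3) (Fin 3) K)))) ≃L[K] Matrix (Fin 3) (Fin 3) K,
      ∀ q, eK q = (2 : K) • (single (0 : Fin 3) (2 : Fin 3) c * (q.1 : Matrix (Fin 3) (Fin 3) K) - (q.1 : Matrix (Fin 3) (Fin 3) K) * single (0 : Fin 3) (2 : Fin 3) c) +
        (q.2 : Matrix (Fin 3) (Fin 3) K) := by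
  set adm : Module.End K (Matrix (Fin 3) (Fin 3) K) :=
    LinearMap.mulLeft K (single (2 : Fin 3) (0 : Fin 3) (1 : K)) - LinearMap.mulRight K (single (2 : Fin 3) (0 : Fin 3) (1 : K)) with hadm
  set N : Matrix (Fin 3) (Fin 3) K := single (0 : Fin 3) (2 : Fin 3) c with hN
  have h2u : IsUnit (2 : K) := isUnit_iff_ne_zero.2 h2
  have hcu : IsUnit c := isUnit_iff_ne_zero.2 hc
  let adN : Module.End K (Matrix (Fin 3) (Fin 3) K) := LinearMap.mulLeft K N - LinearMap.mulRight K N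
  let L : (↥(LinearMap.range adm) × ↥(LinearMap.ker adm)) →ₗ[K] Matrix (Fin 3) (Fin 3) K :=
    (((2 : K) • adN).comp (LinearMap.range adm).subtype).coprod (LinearMap.ker adm).subtype
  have hL : ∀ q : ↥(LinearMap.range adm) × ↥(LinearMap.ker adm),
      L q = (2 : K) • (N * (q.1 : Matrix (Fin 3) (Fin 3) K) - (q.1 : Matrix (Fin 3) (Fin 3) K) * N) + (q.2 : Matrix (Fin 3) (Fin 3) K) := fun q => by
    simp only [L, adN, LinearMap.coprod_apply, LinearMap.comp_apply, LinearMap.smul_apply, Submodule.subtype_apply, LinearMap.sub_apply,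
      LinearMap.mulLeft_apply, LinearMap.mulRight_apply]
  have hinj : Function.Injective L := by
    rw [injective_iff_map_eq_zero]
    rintro ⟨⟨Y, hY⟩, ⟨W, hW⟩⟩ hq
    rw [hL] at hq
    change (2 : K) • (N * Y - Y * N) + W = 0 at hq
    have hYc := (mem_range_ad_single_two_zero_iff Y).1 (by rw [hadm] at hY; exact hY)
    have hWc : W * single (2 : Fin 3) (0 : Fin 3) (1 : K) = single (2 : Fin 3) (0 : Fin 3) 1 * W :=
      (mem_ker_ad_single_two_zero_iff W).1 (by rw [hadm] at hW; exact hW)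
    -- `[N, 2Y] = −W` commutes with `E₂₀`, hence vanishes (★ (D) §4)
    have hb : N * ((2 : K) • Y) - ((2 : K) • Y) * N = -W := by
      rw [Matrix.mul_smul, Matrix.smul_mul, ← smul_sub]
      exact eq_neg_of_add_eq_zero_left hq
    have hcomm : (N * ((2 : K) • Y) - ((2 : K) • Y) * N) * single (2 : Fin 3) (0 : Fin 3) (1 : K) =
        single (2 : Fin 3) (0 : Fin 3) 1 * (N * ((2 : K) • Y) - ((2 : K) • Y) * N) := by
      rw [hb, Matrix.neg_mul, Matrix.mul_neg, hWc]
    have hzero : N * ((2 : K) • Y) - ((2 : K) • Y) * N = 0 := by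
      have h := bracket_eq_zero_of_commute_single_two_zero h2u c ((2 : K) • Y) (by rw [← hN]; exact hcomm)
      rw [← hN] at h
      exact h
    have hW0 : W = 0 := by
      rw [hzero] at hb
      exact neg_eq_zero.1 hb.symm
    have hYb : N * Y - Y * N = 0 := by
      have h' : (2 : K) • (N * Y - Y * N) = 0 := by
        rw [smul_sub, ← Matrix.mul_smul, ← Matrix.smul_mul]
        exact hzero
      exact (smul_eq_zero.1 h').resolve_left h2
    have hY0 : Y = 0 :=
      eq_zero_of_mem_range_of_bracket_eq_zero hcu h2u hYc.1 hYc.2.1 hYc.2.2.1 hYc.2.2.2.1 hYc.2.2.2.2 (by rw [← hN]; exact hYb)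
    ext <;> simp [hY0, hW0]
  have hsurj : Function.Surjective L := by
    intro Z
    obtain ⟨Y, W, hYc, hWc, hZ⟩ := exists_mem_range_bracket_add_centralizer (Units.mk0 c hc) h2u Z
    rw [Units.val_mk0, ← hN] at hZ
    have hY : Y ∈ LinearMap.range adm := by rw [hadm]; exact (mem_range_ad_single_two_zero_iff Y).2 hYc
    have hW : W ∈ LinearMap.ker adm := by rw [hadm]; exact (mem_ker_ad_single_two_zero_iff W).2 hWc
    refine ⟨(⟨(2 : K)⁻¹ • Y, Submodule.smul_mem _ _ hY⟩, ⟨W, hW⟩), ?_⟩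
    rw [hL]
    change (2 : K) • (N * ((2 : K)⁻¹ • Y) - ((2 : K)⁻¹ • Y) * N) + W = Z
    rw [Matrix.mul_smul, Matrix.smul_mul, ← smul_sub, smul_smul, mul_inv_cancel₀ h2, one_smul, hZ]
  let f : (↥(LinearMap.range adm) × ↥(LinearMap.ker adm)) ≃ₗ[K] Matrix (Fin 3) (Fin 3) K := LinearEquiv.ofBijective L ⟨hinj, hsurj⟩
  refine ⟨f.toContinuousLinearEquiv, fun q => ?_⟩
  change f q = _
  rw [LinearEquiv.ofBijective_apply, hL]

omit [CompleteSpace K] in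
/-- The product of two ultrametric (pseudo)metric spaces is ultrametric for the sup distance. [folklore] -/
private theorem isUltrametricDist_prod' {A B : Type*} [PseudoMetricSpace A] [PseudoMetricSpace B] [IsUltrametricDist A] [IsUltrametricDist B] :
    IsUltrametricDist (A × B) := by
  refine ⟨fun x y z => ?_⟩
  rw [Prod.dist_eq, Prod.dist_eq, Prod.dist_eq]
  refine max_le ?_ ?_
  · exact (IsUltrametricDist.dist_triangle_max x.1 y.1 z.1).trans (max_le_max (le_max_left _ _) (le_max_left _ _))
  · exact (IsUltrametricDist.dist_triangle_max x.2 y.2 z.2).trans (max_le_max (le_max_right _ _) (le_max_right _ _))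

omit [CompleteSpace K] [IsUltrametricDist K] [NontriviallyNormedField K] in
/-- A submodule of an ultrametric normed group is ultrametric. [folklore] -/
private theorem isUltrametricDist_submodule' {R : Type*} [Ring R] {E : Type*} [NormedAddCommGroup E] [Module R E] [IsUltrametricDist E] (p : Submodule R E) :
    IsUltrametricDist ↥p := by
  refine ⟨fun x y z => ?_⟩
  have h := IsUltrametricDist.dist_triangle_max (x : E) (y : E) (z : E)
  simpa only [dist_eq_norm, ← Submodule.coe_sub, Submodule.coe_norm] using h

/-- **The conjugation-slice map on ANY pair of subspaces**: for `A ∈ M_n(K)` and `K`-subspaces `Q`, `C` of `M_n(K)` with a continuous linear iso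
`e : Q × C ≃L[K] M_n(K)`, `e (Y, Z) = 2(AY − YA) + Z`, the map `Ψ(Y, Z) = c(Y)(A + Z)c(Y)⁻¹` on `Q × C` has strict derivative `e` at `0` (★ (U) on
`M_n(K) × M_n(K)` composed with the subspace inclusions; the common generalisation of ★ C₁ `hasStrictFDerivAt_slice` and (K2) below).
[cite: HarishChandra1970, Part V §4 Lemma 22] [cite: Schikhof1984, §27] -/
theorem hasStrictFDerivAt_conjSlice {n : Type*} [Fintype n] [DecidableEq n] (A : Matrix n n K) (Q C : Submodule K (Matrix n n K))
    (e : (↥Q × ↥C) ≃L[K] Matrix n n K) (he : ∀ q, e q = (2 : K) • (A * (q.1 : Matrix n n K) - (q.1 : Matrix n n K) * A) + (q.2 : Matrix n n K)) :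
    HasStrictFDerivAt (fun q : ↥Q × ↥C => cayley (q.1 : Matrix n n K) * (A + (q.2 : Matrix n n K)) * Ring.inverse (cayley (q.1 : Matrix n n K)))
      (e : _ →L[K] Matrix n n K) 0 := by
  obtain ⟨D, hD, hΨ⟩ := hasStrictFDerivAt_cayleyConj_add_elementwise (n := n) A
  have hι : HasStrictFDerivAt (fun q : ↥Q × ↥C => ((q.1 : Matrix n n K), (q.2 : Matrix n n K))) (Q.subtypeL.prodMap C.subtypeL) 0 :=
    (Q.subtypeL.prodMap C.subtypeL).hasStrictFDerivAt
  have hcomp := HasStrictFDerivAt.comp (f := fun q : ↥Q × ↥C => ((q.1 : Matrix n n K), (q.2 : Matrix n n K))) 0 hΨ hι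
  refine hcomp.congr_fderiv (ContinuousLinearMap.ext fun q => ?_)
  change D ((q.1 : Matrix n n K), (q.2 : Matrix n n K)) = e q
  rw [hD, he]

/-- **Newton data of the conjugation-slice map on ANY pair of subspaces** (★ D1 `exists_depth_linearNewton_of_hasStrictFDerivAt` on `hasStrictFDerivAt_conjSlice`;
ultrametricity of `Q × C` supplied here). [cite: Schikhof1984, §27 Lemma 27.4–Thm. 27.5] -/
theorem exists_newtonData_conjSlice {n : Type*} [Fintype n] [DecidableEq n] (A : Matrix n n K) (Q C : Submodule K (Matrix n n K))
    (e : (↥Q × ↥C) ≃L[K] Matrix n n K) (he : ∀ q, e q = (2 : K) • (A * (q.1 : Matrix n n K) - (q.1 : Matrix n n K) * A) + (q.2 : Matrix n n K))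
    {r γ : ℝ} (hr : 0 < r) (hγ0 : 0 < γ) (hγ1 : γ < 1) :
    ∃ k₀ : ℕ, ∀ k, k₀ ≤ k → ∀ j, k ≤ j → ∀ x ∈ closedBall (0 : ↥Q × ↥C) (r * γ ^ k), ∀ y ∈ closedBall (0 : ↥Q × ↥C) (r * γ ^ j),
      (fun q : ↥Q × ↥C => cayley (q.1 : Matrix n n K) * (A + (q.2 : Matrix n n K)) * Ring.inverse (cayley (q.1 : Matrix n n K))) (0 + (x + y)) -
        (fun q : ↥Q × ↥C => cayley (q.1 : Matrix n n K) * (A + (q.2 : Matrix n n K)) * Ring.inverse (cayley (q.1 : Matrix n n K))) (0 + x) - e y ∈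
        (e : _ → Matrix n n K) '' closedBall 0 (r * γ ^ (j + 1)) := by
  haveI : IsUltrametricDist (Matrix n n K) := inferInstanceAs (IsUltrametricDist (n → n → K))
  haveI := isUltrametricDist_submodule' Q
  haveI := isUltrametricDist_submodule' C
  haveI : IsUltrametricDist (↥Q × ↥C) := isUltrametricDist_prod'
  exact exists_depth_linearNewton_of_hasStrictFDerivAt (x₀ := 0) e (hasStrictFDerivAt_conjSlice A Q C e he) hr hγ0 hγ1

/-- **(K2) The slice map `Ψ(Y, Z) = c(Y)(N + Z)c(Y)⁻¹` on `Q_K × C_K` has strict derivative `e_K` at `0`** (`hasStrictFDerivAt_conjSlice` at `A = N = c·E₀₂`,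
`Q = range (ad E₂₀)`, `C = ker (ad E₂₀)`; ★ C₁ `hasStrictFDerivAt_slice` with the carriers of the nilpotent pair). [cite: HarishChandra1970, Part V §4 Lemma 22] [cite: Schikhof1984, §27] -/
theorem hasStrictFDerivAt_slodowySlice (c : K)
    (eK : (↥(LinearMap.range (LinearMap.mulLeft K (single (2 : Fin 3) (0 : Fin 3) (1 : K)) - LinearMap.mulRight K (single (2 : Fin 3) (0 : Fin 3) (1 : K)) :
                Module.End K (Matrix (Fin 3) (Fin 3) K))) ×
            ↥(LinearMap.ker (LinearMap.mulLeft K (single (2 : Fin 3) (0 : Fin 3) (1 : K)) - LinearMap.mulRight K (single (2 : Fin 3) (0 : Fin 3) (1 : K)) :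
                Module.End K (Matrix (Fin 3) (Fin 3) K)))) ≃L[K] Matrix (Fin 3) (Fin 3) K)
    (heK : ∀ q, eK q = (2 : K) • (single (0 : Fin 3) (2 : Fin 3) c * (q.1 : Matrix (Fin 3) (Fin 3) K) - (q.1 : Matrix (Fin 3) (Fin 3) K) * single (0 : Fin 3) (2 : Fin 3) c) +
        (q.2 : Matrix (Fin 3) (Fin 3) K)) :
    HasStrictFDerivAt
      (fun q : ↥(LinearMap.range (LinearMap.mulLeft K (single (2 : Fin 3) (0 : Fin 3) (1 : K)) - LinearMap.mulRight K (single (2 : Fin 3) (0 : Fin 3) (1 : K)) :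
                  Module.End K (Matrix (Fin 3) (Fin 3) K))) ×
              ↥(LinearMap.ker (LinearMap.mulLeft K (single (2 : Fin 3) (0 : Fin 3) (1 : K)) - LinearMap.mulRight K (single (2 : Fin 3) (0 : Fin 3) (1 : K)) :
                  Module.End K (Matrix (Fin 3) (Fin 3) K))) =>
        cayley (q.1 : Matrix (Fin 3) (Fin 3) K) * (single (0 : Fin 3) (2 : Fin 3) c + (q.2 : Matrix (Fin 3) (Fin 3) K)) * Ring.inverse (cayley (q.1 : Matrix (Fin 3) (Fin 3) K)))
      (eK : _ →L[K] Matrix (Fin 3) (Fin 3) K) 0 :=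
  hasStrictFDerivAt_conjSlice (single (0 : Fin 3) (2 : Fin 3) c) _ _ eK heK

/-- **(K3) NEWTON DATA for the slice map on `Q_K × C_K`** (`exists_newtonData_conjSlice` at the nilpotent pair; base point `0`; any box size `r > 0`, ratio
`γ ∈ (0,1)`; ★ C₁ `exists_newtonData_K` with the carriers swapped). [cite: Schikhof1984, §27 Lemma 27.4–Thm. 27.5] -/
theorem exists_newtonData_slodowyK (c : K)
    (eK : (↥(LinearMap.range (LinearMap.mulLeft K (single (2 : Fin 3) (0 : Fin 3) (1 : K)) - LinearMap.mulRight K (single (2 : Fin 3) (0 : Fin 3) (1 : K)) :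
                Module.End K (Matrix (Fin 3) (Fin 3) K))) ×
            ↥(LinearMap.ker (LinearMap.mulLeft K (single (2 : Fin 3) (0 : Fin 3) (1 : K)) - LinearMap.mulRight K (single (2 : Fin 3) (0 : Fin 3) (1 : K)) :
                Module.End K (Matrix (Fin 3) (Fin 3) K)))) ≃L[K] Matrix (Fin 3) (Fin 3) K)
    (heK : ∀ q, eK q = (2 : K) • (single (0 : Fin 3) (2 : Fin 3) c * (q.1 : Matrix (Fin 3) (Fin 3) K) - (q.1 : Matrix (Fin 3) (Fin 3) K) * single (0 : Fin 3) (2 : Fin 3) c) +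
        (q.2 : Matrix (Fin 3) (Fin 3) K))
    {r γ : ℝ} (hr : 0 < r) (hγ0 : 0 < γ) (hγ1 : γ < 1) :
    ∃ k₀ : ℕ, ∀ k, k₀ ≤ k → ∀ j, k ≤ j →
      ∀ x ∈ closedBall (0 : ↥(LinearMap.range (LinearMap.mulLeft K (single (2 : Fin 3) (0 : Fin 3) (1 : K)) - LinearMap.mulRight K (single (2 : Fin 3) (0 : Fin 3) (1 : K)) :
                  Module.End K (Matrix (Fin 3) (Fin 3) K))) ×
              ↥(LinearMap.ker (LinearMap.mulLeft K (single (2 : Fin 3) (0 : Fin 3) (1 : K)) - LinearMap.mulRight K (single (2 : Fin 3) (0 : Fin 3) (1 : K)) :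
                  Module.End K (Matrix (Fin 3) (Fin 3) K)))) (r * γ ^ k),
      ∀ y ∈ closedBall (0 : ↥(LinearMap.range (LinearMap.mulLeft K (single (2 : Fin 3) (0 : Fin 3) (1 : K)) - LinearMap.mulRight K (single (2 : Fin 3) (0 : Fin 3) (1 : K)) :
                  Module.End K (Matrix (Fin 3) (Fin 3) K))) ×
              ↥(LinearMap.ker (LinearMap.mulLeft K (single (2 : Fin 3) (0 : Fin 3) (1 : K)) - LinearMap.mulRight K (single (2 : Fin 3) (0 : Fin 3) (1 : K)) :
                  Module.End K (Matrix (Fin 3) (Fin 3) K)))) (r * γ ^ j),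
        (fun q : ↥(LinearMap.range (LinearMap.mulLeft K (single (2 : Fin 3) (0 : Fin 3) (1 : K)) - LinearMap.mulRight K (single (2 : Fin 3) (0 : Fin 3) (1 : K)) :
                  Module.End K (Matrix (Fin 3) (Fin 3) K))) ×
              ↥(LinearMap.ker (LinearMap.mulLeft K (single (2 : Fin 3) (0 : Fin 3) (1 : K)) - LinearMap.mulRight K (single (2 : Fin 3) (0 : Fin 3) (1 : K)) :
                  Module.End K (Matrix (Fin 3) (Fin 3) K))) =>
          cayley (q.1 : Matrix (Fin 3) (Fin 3) K) * (single (0 : Fin 3) (2 : Fin 3) c + (q.2 : Matrix (Fin 3) (Fin 3) K)) *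
            Ring.inverse (cayley (q.1 : Matrix (Fin 3) (Fin 3) K))) (0 + (x + y)) -
          (fun q : ↥(LinearMap.range (LinearMap.mulLeft K (single (2 : Fin 3) (0 : Fin 3) (1 : K)) - LinearMap.mulRight K (single (2 : Fin 3) (0 : Fin 3) (1 : K)) :
                  Module.End K (Matrix (Fin 3) (Fin 3) K))) ×
              ↥(LinearMap.ker (LinearMap.mulLeft K (single (2 : Fin 3) (0 : Fin 3) (1 : K)) - LinearMap.mulRight K (single (2 : Fin 3) (0 : Fin 3) (1 : K)) :
                  Module.End K (Matrix (Fin 3) (Fin 3) K))) =>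
          cayley (q.1 : Matrix (Fin 3) (Fin 3) K) * (single (0 : Fin 3) (2 : Fin 3) c + (q.2 : Matrix (Fin 3) (Fin 3) K)) *
            Ring.inverse (cayley (q.1 : Matrix (Fin 3) (Fin 3) K))) (0 + x) - eK y ∈
          (eK : _ → Matrix (Fin 3) (Fin 3) K) '' closedBall 0 (r * γ ^ (j + 1)) :=
  exists_newtonData_conjSlice (single (0 : Fin 3) (2 : Fin 3) c) _ _ eK heK hr hγ0 hγ1

end KLevel

end Summit.HodgeConjecture.HodgeConjecture.Cruxes.H413.F0P3cStCharTSHCDSlodowySliceK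

end
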